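import Summits.Ventures.GridStability.Models.SMIBEnergyRoa
import Summits.Ventures.GridStability.Models.SMIBInstanceGFM
import Summits.Ventures.GridStability.Models.AngleEnclosure

/-!
# GridStability/Models/SMIBEnergyRoaGFM — the energy route on the G3.a instance of record «GFM-SMIB-QoriaV4 (phys)», hypothesis-free

Cell `gridfusion` (LADDER-GRIDFUSION rung G3.a «droop/VSM grid-forming inverter ≡ SMIB», director
RULING 16 (a); lead ruling 21:11:37Z: instance OF RECORD = PHYSICAL reading), seat gridfusion-model-1,
`plan/PARTITION.md` §0 row `Models/`. THREE COLUMNS: MODELLED column only — model `M_smib` record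
`SMIB.gfmQoriaV4Phys` (p468783/p470417) = model-3's converter record `InverterDroop.gfmSmibQoriaV4.toGridSMIB`
(`gfmQoriaV4Phys_eq_toGridSMIB`), MODEL-VALIDITY «MV-6D+MV-P+MV-Ω(ω_b′ = 35500/113)»; a-priori theorems
about its solutions via the textbook energy function (lit-6 p465446 through `SMIB.energyWell_roa`,
p479609); NOT an SOS certificate, no sentence about any converter or grid.

* `deltaQV4_gt` / `deltaQV4_lt` — certified enclosure `0.1253 < δˢ < 0.1254` of the equilibrium angle
  of record `δˢ = arcsin(2072640/16581121)` (generic chains of `AngleEnclosure`, side goals `norm_num`);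
* `gfmQoriaV4Phys_toLit`, `gfmQoriaV4Phys_criticalEnergy_eq` / `_gt` — lit-2 record
  `⟨113/3550, 3729/3550, 8290560/16581121, 4⟩`, `V_cr = 8c* − P_m′(π − 2δˢ)`, certified `6.4917 < V_cr`
  (float 6.491786);
* `gfmQoriaV4Phys_energyWell_roa` — HYPOTHESIS-FREE: every solution on `[0, ∞)` with
  `δ(0) ∈ (−π − δˢ, π − δˢ)` and ENERGY `V(δ(0), ω(0)) ≤ 6.4917` keeps the window and `V ≤ 6.4917` and
  tends to `(δˢ, 0)`; the τ-time sibling `gfmQoriaV4` has the same `P_m′, P_M`, hence the same `V_cr`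
  and the same statement (`gfmQoriaV4_energyWell_roa`).

Energy-function twin of the G3.a SOS -roa sentences (lyap-1 p470551/p475563/p475846 over the Bench
certificates; model-3 p471944 on the converter model): two kernel inner estimates of one model's ROA,
VALIDATED-comparison material only (Qoria §V.4 printed clearing times are VALIDATED comparators).
MODELLED: MV-6D+MV-P+MV-Ω.
-/

noncomputable section

open Real Set Filter Topology

namespace Summit.Ventures.GridStability.Models.SMIB

open AngleEnclosure

/-- `cos (arcsin s*) = c*` for the G3.a circle point (from `cos_deltaQV4`). -/
theorem cos_arcsin_sQV4 : cos (arcsin (sQV4 : ℝ)) = (cQV4 : ℝ) := cos_deltaQV4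

/-- Certified lower bound `0.1253 < δˢ` (`δˢ = 0.1253278…`). -/
theorem deltaQV4_gt : (1253 / 10000 : ℝ) < deltaQV4 := by
  have h := cos_arcsin_sQV4
  simp only [sQV4, cQV4] at h
  push_cast at h
  rw [deltaQV4]
  simp only [sQV4]; push_cast
  refine arcsin_gt_of_chain5 h (by norm_num) (by linarith [pi_gt_three]) ?_ ?_ ?_ ?_ ?_ ?_ <;>
    norm_num [dbl, cosLower5]

/-- Certified upper bound `δˢ < 0.1254`. -/
theorem deltaQV4_lt : deltaQV4 < (1254 / 10000 : ℝ) := by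
  have h := cos_arcsin_sQV4
  simp only [sQV4, cQV4] at h
  push_cast at h
  rw [deltaQV4]
  simp only [sQV4]; push_cast
  refine arcsin_lt_of_chain h (by norm_num) (by linarith [pi_gt_three]) ?_
  norm_num [dbl, cosUpper4]

/-- `0 < δˢ` for the G3.a angle of record. -/
theorem deltaQV4_pos : 0 < deltaQV4 := lt_trans (by norm_num) deltaQV4_gt

/-- `δˢ < π/2` for the G3.a angle of record. -/
theorem deltaQV4_lt_pi_div_two : deltaQV4 < π / 2 := by
  linarith [deltaQV4_lt, pi_gt_three]

/-- lit-2 record of the instance of record (physical reading): `⟨113/3550, 3729/3550, P_m′, 4⟩`. -/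
theorem gfmQoriaV4Phys_toLit :
    gfmQoriaV4Phys.toLit = ⟨113 / 3550, 3729 / 3550, 8290560 / 16581121, 4⟩ := by
  simp only [toLit, gfmQoriaV4Phys, sub_zero]

/-- lit-2 record of the τ-time sibling: `⟨4, 4086/347, P_m′, 4⟩`. -/
theorem gfmQoriaV4_toLit : gfmQoriaV4.toLit = ⟨4, 4086 / 347, 8290560 / 16581121, 4⟩ := by
  simp only [toLit, gfmQoriaV4, sub_zero]

/-- Critical energy in closed form (both readings share `P_m′`, `P_M`):
`V_cr(δˢ) = 2·4·c* − P_m′(π − 2δˢ)`. -/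
theorem gfmQoriaV4Phys_criticalEnergy_eq :
    gfmQoriaV4Phys.toLit.criticalEnergy deltaQV4 =
      2 * (4 : ℝ) * (cQV4 : ℝ) - (8290560 / 16581121 : ℝ) * (π - 2 * deltaQV4) := by
  rw [Literature.MathematicalPhysics.PowerSystems.SMIB.criticalEnergy, gfmQoriaV4Phys_toLit,
    cos_deltaQV4]
  ring

/-- The τ-time sibling has the same critical energy (same `P_m′`, `P_M`, `δˢ`). -/
theorem gfmQoriaV4_criticalEnergy_eq :
    gfmQoriaV4.toLit.criticalEnergy deltaQV4 = gfmQoriaV4Phys.toLit.criticalEnergy deltaQV4 := by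
  rw [gfmQoriaV4Phys_criticalEnergy_eq, Literature.MathematicalPhysics.PowerSystems.SMIB.criticalEnergy,
    gfmQoriaV4_toLit, cos_deltaQV4]
  ring

/-- Certified `6.4917 < V_cr` (float 6.491786; `π < 3.141593`, `0.1253 < δˢ`). -/
theorem gfmQoriaV4Phys_criticalEnergy_gt :
    (64917 / 10000 : ℝ) < gfmQoriaV4Phys.toLit.criticalEnergy deltaQV4 := by
  rw [gfmQoriaV4Phys_criticalEnergy_eq]
  have hπ := Real.pi_lt_d6
  have hδ := deltaQV4_gt
  norm_num [cQV4] at hπ hδ ⊢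
  nlinarith

/-- **Energy route on the G3.a instance of record, hypothesis-free.** MODELLED: `M_smib` record
`gfmQoriaV4Phys` ≡ droop-GFM converter vs infinite bus (model-3 bridge), MV-6D+MV-P+MV-Ω. Every solution
on `[0, ∞)` with `δ(0) ∈ (−π − δˢ, π − δˢ)` and energy `V(δ(0), ω(0)) ≤ 6.4917` keeps the window and
`V ≤ 6.4917` for all `t ≥ 0` and converges to `(δˢ, 0)`. No sentence about a converter or a grid. -/
theorem gfmQoriaV4Phys_energyWell_roa {X : ℝ → ℝ × ℝ} (hX : gfmQoriaV4Phys.IsSolutionOn X (Ici 0))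
    (h₁ : (X 0).1 ∈ Ioo (-π - deltaQV4) (π - deltaQV4))
    (h₂ : gfmQoriaV4Phys.energy deltaQV4 (X 0) ≤ 64917 / 10000) :
    (∀ t, 0 ≤ t → (X t).1 ∈ Ioo (-π - deltaQV4) (π - deltaQV4) ∧
        gfmQoriaV4Phys.energy deltaQV4 (X t) ≤ 64917 / 10000) ∧
      Tendsto X atTop (𝓝 (deltaQV4, 0)) :=
  energyWell_roa_Ici (p := gfmQoriaV4Phys) rfl (by norm_num [gfmQoriaV4Phys])
    (by norm_num [gfmQoriaV4Phys]) (by norm_num [gfmQoriaV4Phys]) gfmQoriaV4Phys_isEquilibrium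
    deltaQV4_pos.le deltaQV4_lt_pi_div_two gfmQoriaV4Phys_criticalEnergy_gt hX h₁ h₂

/-- The same statement for the τ-time sibling `gfmQoriaV4` (scaled time; same `V_cr`, energies in the
scaled units of that record). -/
theorem gfmQoriaV4_energyWell_roa {X : ℝ → ℝ × ℝ} (hX : gfmQoriaV4.IsSolutionOn X (Ici 0))
    (h₁ : (X 0).1 ∈ Ioo (-π - deltaQV4) (π - deltaQV4))
    (h₂ : gfmQoriaV4.energy deltaQV4 (X 0) ≤ 64917 / 10000) :
    (∀ t, 0 ≤ t → (X t).1 ∈ Ioo (-π - deltaQV4) (π - deltaQV4) ∧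
        gfmQoriaV4.energy deltaQV4 (X t) ≤ 64917 / 10000) ∧
      Tendsto X atTop (𝓝 (deltaQV4, 0)) :=
  energyWell_roa_Ici (p := gfmQoriaV4) rfl (by norm_num [gfmQoriaV4])
    (by norm_num [gfmQoriaV4]) (by norm_num [gfmQoriaV4]) gfmQoriaV4_isEquilibrium
    deltaQV4_pos.le deltaQV4_lt_pi_div_two
    (by rw [gfmQoriaV4_criticalEnergy_eq]; exact gfmQoriaV4Phys_criticalEnergy_gt) hX h₁ h₂

end Summit.Ventures.GridStability.Models.SMIB

end
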